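import Mathlib
import Summits.Ventures.HodgeRepro.Tier4.Common.TorusPath

/-!
# Tier4/Line4/LocalTorusSurj — LOCAL-TORUS SURJECTIVITY at a real CM place: every unit complex number is the
first-line (resp. second-line) weight of an element of the local torus `T_w` whose other weight is `1`
(cut C-L4-LOCAL-TORUS-SURJ, the displayed `hsurj` of KTypeIntegers p719550's integers form (6), discharged by name)

Blind re-derivation cell `pub-hodge-repro`, Tier 4 «prove the step» (README §9–§10), seat t4-L1-p4 (gen 6), LINE L4,
self-named default plate S16393 on t4-L4-x2 g2's candidate cut (S16378) / crit-1 g13's reading (S16385).  Target tree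
path `lean/Summits/Ventures/HodgeRepro/Tier4/Line4/LocalTorusSurj.lean`.  Imports: Mathlib + `Common.TorusPath`
(`torusPath`, `mat_torusPath`, `torusPath_mem_torusT`, `torusPath_mem_localTorusAt`, `weightAt_torusPath`,
`mat_torusPath_map_eq_one`, `blockDiag4R_map`, `blockOf_map`, `normForm_one_zero`); through it `TorusPathAdeles`
(`xiR`, `etaR`, `adOne`, `adZero`, `normForm_adOne_adZero`, `normForm_xi_eta`, `xi_add_eta_mul_wroot`, `adToC_adOne`,
`adToC_adZero`, the component lemmas), `RowTorus` (`torusUnit`, `mem_torusT_ofLinesRow_of_blocks`, `blockOf_one_zero`),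
`RowWeights` (`weightAt_zero_of_mat`, `weightAt_one_of_mat`), `LocalTorusCompact` (`finiteComponent_eq_one_iff`,
`infiniteComponent_eq_one_iff`).  No literature; NO definition (kind proof): the second-line witness is written out
inside its existence proof.

THE STATEMENT.  On the row plane `ofLinesRow q a b ε` at a real CM place `w₀` (`w₀.IsReal`, `IsCMAt q w₀`), for every
`z ∈ ℂ` with `‖z‖ = 1` there is `κ ∈ T` supported at `w₀` with `u₀(κ) = z` and `u₁(κ) = 1`
(`exists_mem_localTorusAt_weightAt_zero_eq`), and one with `u₀(κ) = 1`, `u₁(κ) = z`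
(`exists_mem_localTorusAt_weightAt_one_eq`): the local torus `T_{w₀} ≅ U(1) × U(1)` is hit coordinatewise.
PROOF.  `z = cos θ + i sin θ` with `θ = arg z` (Mathlib `Complex.norm_mul_cos_add_sin_mul_I`); TorusPath's
`torusPath θ` (block `adOne (ξ θ) + adZero (η θ) ω` on the first line, `1` on the second) has first-line weight
`cos θ + i sin θ` (`weightAt_torusPath`) and second-line weight `adToC 1 + adToC 0 · ω = 1` (`weightAt_one_torusPath`,
new); the second-line witness (blocks swapped: `1` and `adOne (ξ θ) + adZero (η θ) ω`) is an element of the torus by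
RowTorus's `mem_torusT_ofLinesRow_of_blocks`, is supported at `w₀` by the same component lemmas
(`mem_localTorusAt_of_mat_secondLine`), and has the weights swapped (`weightAt_zero_of_mat` / `weightAt_one_of_mat`).
**`localTorus_surj_seesaw_one`** reads both on the seesaw plane `(mixedRow q (a 0) (a 2)).withTransportedTorus 1 1 …`
at `g = g′ = 1` (its group, torus, local tori and weights are the row plane's: `B`, `Ω`, `P` unchanged by the
transport — the reading of TorusPath's `nhdsWithin_compl_singleton_neBot_seesaw` and KTypeIntegers'
`weightAt_ne_zero_of_mem_torusT`), under the skeleton's binder `hall : ∀ w, w.IsReal ∧ IsCMAt q w`: this is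
KTypeIntegers' `hsurj` VERBATIM, so the integers form (6) holds with `hsurj` discharged — consumer
`forall_chi_mul_torusWeight'_inv_eq_one_iff_integers … (localTorus_surj_seesaw_one q a hgg' hg'g hgΩ hall)`
(the bind lives in the companion module `Line4/KTypeIntegersSurj.lean`, which imports KTypeIntegers).

Hypotheses displayed: `w₀.IsReal`, `IsCMAt q w₀` (the path's), `hall` (the seesaw statement's).  Nothing here says
anything about the status of the Hodge conjecture for CM abelian varieties, which is NOT proved (HC_CM is NOT proved by
anyone in this repository).
-/

set_option autoImplicit false

noncomputable section

namespace Summit.Ventures.HodgeRepro.Tier4.Line4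

open Summit.Ventures.HodgeRepro.Tier4.Common NumberField IsDedekindDomain Matrix
open scoped Classical

section Path

variable {k : Type} [Field k] [NumberField k] (q : QuadData k) (a b ε : k) {w₀ : InfinitePlace k}
  (hw : w₀.IsReal) (hcm : IsCMAt q w₀)

/-- **The second-line weight of `torusPath θ` is `1`** (its second block is `1 + 0 · ω`). -/
theorem weightAt_one_torusPath (θ : ℝ) :
    weightAt (PlaneData.ofLinesRow q a b ε) q w₀ 1 (torusPath q a b ε hw hcm θ) = 1 := by
  rw [weightAt_one_of_mat q w₀ _ _ _ _ _ _ (mat_torusPath q a b ε hw hcm θ), map_one, map_zero, zero_mul, add_zero]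

/-- **The components of a torus element whose matrix is `blockDiag (1, adOne ξ + adZero η · ω)`** (the second-line
twin of TorusPath's path): it is supported at `w₀` — the finite components and the components at `w ≠ w₀` are `1`
because `adOne`/`adZero` are `1`/`0` there (TorusPath's `mat_torusPath_map_eq_one` argument, blocks swapped). -/
theorem mem_localTorusAt_of_mat_secondLine (θ : ℝ) {κ : GA (PlaneData.ofLinesRow q a b ε)}
    (hκ : κ ∈ torusT (PlaneData.ofLinesRow q a b ε))
    (hmat : GA.mat (PlaneData.ofLinesRow q a b ε) κ =
      blockDiag4R (blockOf (algebraMap k (Ad k) q.t) (algebraMap k (Ad k) q.n) 1 0)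
        (blockOf (algebraMap k (Ad k) q.t) (algebraMap k (Ad k) q.n) (adOne hw (xiR q w₀ θ))
          (adZero hw (etaR q w₀ θ)))) :
    κ ∈ localTorusAt (PlaneData.ofLinesRow q a b ε) w₀ := by
  have hmap : ∀ {S : Type} [CommRing S] (f : Ad k →+* S), f (adOne hw (xiR q w₀ θ)) = 1 →
      f (adZero hw (etaR q w₀ θ)) = 0 → (GA.mat (PlaneData.ofLinesRow q a b ε) κ).map f = 1 := by
    intro S _ f h1 h0
    rw [hmat, blockDiag4R_map, blockOf_map, blockOf_map, h1, h0, map_one, map_zero, blockOf_one_zero,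
      blockDiag4R_one]
  refine ⟨hκ, ?_, ?_⟩
  · intro v
    rw [finiteComponent_eq_one_iff]
    intro i j
    have h := hmap (adComponentFin k v) (adComponentFin_adOne hw v _) (adComponentFin_adZero hw v _)
    have := congrFun (congrFun h i) j
    rwa [Matrix.map_apply] at this
  · intro w hww
    rw [infiniteComponent_eq_one_iff]
    intro i j
    have h := hmap (adComponentInf k w) (adComponentInf_adOne_of_ne hw hww _) (adComponentInf_adZero_of_ne hw hww _)
    have := congrFun (congrFun h i) j
    rwa [Matrix.map_apply] at this

/-- A unit complex number is `cos (arg z) + i sin (arg z)` (real cosine and sine, cast). -/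
theorem eq_cos_arg_add_sin_arg_mul_I {z : ℂ} (hz : ‖z‖ = 1) :
    (Real.cos (Complex.arg z) : ℂ) + (Real.sin (Complex.arg z) : ℂ) * Complex.I = z := by
  have h := Complex.norm_mul_cos_add_sin_mul_I z
  rw [hz, Complex.ofReal_one, one_mul] at h
  rw [Complex.ofReal_cos, Complex.ofReal_sin]
  exact h

include hw hcm in
/-- **Surjectivity on the first line**: every unit complex number `z` is the first-line weight of an element of the
torus supported at `w₀` whose second-line weight is `1`. -/
theorem exists_mem_localTorusAt_weightAt_zero_eq (z : ℂ) (hz : ‖z‖ = 1) :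
    ∃ κ : torusT (PlaneData.ofLinesRow q a b ε),
      (κ : GA (PlaneData.ofLinesRow q a b ε)) ∈ localTorusAt (PlaneData.ofLinesRow q a b ε) w₀ ∧
      weightAt (PlaneData.ofLinesRow q a b ε) q w₀ 0 (κ : GA (PlaneData.ofLinesRow q a b ε)) = z ∧
      weightAt (PlaneData.ofLinesRow q a b ε) q w₀ 1 (κ : GA (PlaneData.ofLinesRow q a b ε)) = 1 :=
  ⟨⟨torusPath q a b ε hw hcm (Complex.arg z), torusPath_mem_torusT q a b ε hw hcm _⟩,
    torusPath_mem_localTorusAt q a b ε hw hcm _,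
    by rw [weightAt_torusPath]; exact eq_cos_arg_add_sin_arg_mul_I hz,
    weightAt_one_torusPath q a b ε hw hcm _⟩

include hw hcm in
/-- **Surjectivity on the second line**: every unit complex number `z` is the second-line weight of an element of the
torus supported at `w₀` whose first-line weight is `1` (the witness: the blocks `1` and `adOne (ξ θ) + adZero (η θ) ω`,
`θ = arg z`, an element of the torus by RowTorus's `mem_torusT_ofLinesRow_of_blocks`). -/
theorem exists_mem_localTorusAt_weightAt_one_eq (z : ℂ) (hz : ‖z‖ = 1) :
    ∃ κ : torusT (PlaneData.ofLinesRow q a b ε),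
      (κ : GA (PlaneData.ofLinesRow q a b ε)) ∈ localTorusAt (PlaneData.ofLinesRow q a b ε) w₀ ∧
      weightAt (PlaneData.ofLinesRow q a b ε) q w₀ 0 (κ : GA (PlaneData.ofLinesRow q a b ε)) = 1 ∧
      weightAt (PlaneData.ofLinesRow q a b ε) q w₀ 1 (κ : GA (PlaneData.ofLinesRow q a b ε)) = z := by
  have h₁ := normForm_adOne_adZero q hw (normForm_xi_eta hcm (Complex.arg z))
  obtain ⟨hu, hT⟩ := mem_torusT_ofLinesRow_of_blocks q a b ε 1 0 _ _ (normForm_one_zero q) h₁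
  refine ⟨⟨⟨torusUnit q 1 0 _ _ (normForm_one_zero q) h₁, hu⟩, hT⟩, ?_, ?_, ?_⟩
  · exact mem_localTorusAt_of_mat_secondLine q a b ε hw (Complex.arg z) hT rfl
  · rw [weightAt_zero_of_mat q w₀ _ _ _ _ _ _ rfl, map_one, map_zero, zero_mul, add_zero]
  · rw [weightAt_one_of_mat q w₀ _ _ _ _ _ _ rfl, adToC_adOne, adToC_adZero]
    exact (xi_add_eta_mul_wroot hw hcm (Complex.arg z)).trans (eq_cos_arg_add_sin_arg_mul_I hz)

end Path

section Seesaw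

variable {k : Type} [Field k] [NumberField k] (q : QuadData k) (a : Fin 4 → k)
  (hgg' : (1 : Matrix (Fin 4) (Fin 4) k) * 1 = 1) (hg'g : (1 : Matrix (Fin 4) (Fin 4) k) * 1 = 1)
  (hgΩ : (1 : Matrix (Fin 4) (Fin 4) k) * (PlaneData.mixedRow q (a 0) (a 2)).Ω = (PlaneData.mixedRow q (a 0) (a 2)).Ω * 1)

/-- **LOCAL-TORUS SURJECTIVITY on the seesaw plane at `g = g′ = 1`** — KTypeIntegers' displayed `hsurj` VERBATIM, under
the skeleton's binder `hall` (every infinite place of `k` real and CM for `q`): at every place `w`, every unit complex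
number is the first-line weight of an element of `T_w` with second-line weight `1`, and the second-line weight of one
with first-line weight `1`.  The seesaw plane's group, torus, local tori and weights are the row plane
`ofLinesRow q (a 0) (a 2) (−1)`'s (the transport by `g = g′ = 1` changes none of `B`, `Ω`, `P`). -/
theorem localTorus_surj_seesaw_one (hall : ∀ w : InfinitePlace k, w.IsReal ∧ IsCMAt q w) :
    ∀ w : InfinitePlace k, ∀ z : ℂ, ‖z‖ = 1 →
      (∃ κ : torusT ((PlaneData.mixedRow q (a 0) (a 2)).withTransportedTorus 1 1 hgg' hg'g hgΩ),
        (κ : GA ((PlaneData.mixedRow q (a 0) (a 2)).withTransportedTorus 1 1 hgg' hg'g hgΩ)) ∈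
          localTorusAt ((PlaneData.mixedRow q (a 0) (a 2)).withTransportedTorus 1 1 hgg' hg'g hgΩ) w ∧
        weightAt ((PlaneData.mixedRow q (a 0) (a 2)).withTransportedTorus 1 1 hgg' hg'g hgΩ) q w 0
          (κ : GA ((PlaneData.mixedRow q (a 0) (a 2)).withTransportedTorus 1 1 hgg' hg'g hgΩ)) = z ∧
        weightAt ((PlaneData.mixedRow q (a 0) (a 2)).withTransportedTorus 1 1 hgg' hg'g hgΩ) q w 1
          (κ : GA ((PlaneData.mixedRow q (a 0) (a 2)).withTransportedTorus 1 1 hgg' hg'g hgΩ)) = 1) ∧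
      (∃ κ : torusT ((PlaneData.mixedRow q (a 0) (a 2)).withTransportedTorus 1 1 hgg' hg'g hgΩ),
        (κ : GA ((PlaneData.mixedRow q (a 0) (a 2)).withTransportedTorus 1 1 hgg' hg'g hgΩ)) ∈
          localTorusAt ((PlaneData.mixedRow q (a 0) (a 2)).withTransportedTorus 1 1 hgg' hg'g hgΩ) w ∧
        weightAt ((PlaneData.mixedRow q (a 0) (a 2)).withTransportedTorus 1 1 hgg' hg'g hgΩ) q w 0
          (κ : GA ((PlaneData.mixedRow q (a 0) (a 2)).withTransportedTorus 1 1 hgg' hg'g hgΩ)) = 1 ∧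
        weightAt ((PlaneData.mixedRow q (a 0) (a 2)).withTransportedTorus 1 1 hgg' hg'g hgΩ) q w 1
          (κ : GA ((PlaneData.mixedRow q (a 0) (a 2)).withTransportedTorus 1 1 hgg' hg'g hgΩ)) = z) :=
  fun w z hz =>
    ⟨exists_mem_localTorusAt_weightAt_zero_eq q (a 0) (a 2) (-1) (hall w).1 (hall w).2 z hz,
      exists_mem_localTorusAt_weightAt_one_eq q (a 0) (a 2) (-1) (hall w).1 (hall w).2 z hz⟩

end Seesaw

end Summit.Ventures.HodgeRepro.Tier4.Line4

end
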